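import Literature.AlgebraicGeometry.Hironaka2017.S16Proof.R019cReadings
import Literature.AlgebraicGeometry.Hironaka2017.S15ARSchemes.R094cNablaClosed
import HarnessLib

/-!
# [OURS · L1 W4.6 / W4.7] The TYPED Th. 16.6 procedure as a DEFINITION — shared transcription module of the
# statement campaigns s46 (restricted-regime rungs) and s47 (negative side) of cell res-hironaka
# (LADDER-RESOLUTION rung L, D-0089); host route MarkedTransfer, host item `HypersurfaceOrderReduction`
# (stmt-ResolutionOfSingularities-16155), `--kind definition --supports`

HONEST FRAMING. Every declaration below is OURS (a campaign definition of the res-hironaka cell, slots W4.6/W4.7, typed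
by res-L1-type-o1 in the statement-only lane on the brief plan/SIZED-ASK-L.md v0.2 §U «o1 starts NOW (row 019
complete): first file = the s46 / s47 shared transcription module Theorems/MarkedTransferCampaignW46TypedProcedure.lean
(the procedure-as-definition over S16Proof.* carriers: centre-rule data, Invmax-string, one step) that both the s46 rungs
and the s47 negations import») or pure logic; NOTHING here is a statement of H. Hironaka's manuscript *Resolution of
singularities in positive characteristics* (2017-03-23, [Hironaka2017], lit key `paper:url-3343fd9e678b`) and nothing
here asserts that any statement of that manuscript holds. The manuscript enters ONLY through the TYPED CANDIDATE
CARRIERS of rung S (`Literature.AlgebraicGeometry.Hironaka2017.S15ARSchemes.YSequence` = Eq. (123) / Def. 15.8,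
`YSequence.Terminal` / `nabla` = Def. 15.11 / 15.12, `S16Proof.MTIDatum` + `MTIDatum.ofARSchemes` = the résumé Th. 16.6
quantifies over, `S16Proof.Thm16_6_2` / `Thm16_6_2_mle` / `InvString.LexLT` = Eq. (127) and «m′ ≤ m»,
`MTIDatum.transformT`, `InvReadingR1/R2/R3`), used as DEFINITIONS of what «the procedure» is, and through typed
candidate CLAIMS used as HYPOTHESIS FIELDS (`YSequence.Def15_12_smoothAt`, `Def15_12_inclAt`: «∇(E) is smooth closed
non-empty», «∇(E) ⊆ Sing(Ě) ⊆ Sing(E)», Def. 15.12 p.80 l.37 – p.81 l.2) — never asserted. The only admissible external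
premises of the campaigns are FACT-LIST §A/§B named facts taken as hypotheses (none is needed in this file). AI review
is weaker than expert review. No `sorry`, no theorem: this module is STATEMENT-ONLY (definitions); the pure-logic anchors
(`Resume.mti_isStandard`, `IsCentre.isPermissibleCentre`, `decreaseAlongSteps_of_thm16_6`, antitonicity) are the
companion module `MarkedTransferCampaignW46TypedProcedureAnchors`.

## What «the typed Th. 16.6 procedure» is here (p.84 l.4–20 with §16.3 p.87 l.14–17 «we apply Th.(16.6) … repeatedly
## … replacing 𝔜's by their transforms»; Rem. 16.2 (1) p.81 l.17–22) — decl map (namespace `…Theorems.CampaignW46`)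

* `Notions n` — the NOTION PARAMETERS of the rung-S carriers, bundled and made scheme-polymorphic (a run changes the
  ambient scheme at every blow-up): `arRed`/`arEq` (AR-reduction / AR-equivalence, rows 026/027), `inSOn` («∈ 𝔖(F(Y))»,
  row 026), `coreFocus` (Eqs. (43)/(44), row 010), `IsCotGen` (cotangential generators, rows 015/087), `vrank` (row
  006), `inv` (Eq. (34) `Inv_ξ`, row 007) — exactly the parameters of `S15ARSchemes.YStep`/`YSequence` and
  `S16Proof.InvReadingR1`; every campaign statement is RELATIVE TO an `N : Notions n` and says which instance it takes.
* `Resume N A E` — THE RÉSUMÉ OF `E` on the ambient `A` (§2 p.4 l.22–24, row 001 `AmbientDatum`): a 𝔜-sequence (123) of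
  `E` (row 091 `YSequence`, whose step data already carry «`J(s) ≠ (0)`, `b(s) > 0`»), a terminal index `t` (Def. 15.11,
  row 094 `YTerminal`), the two Def. 15.12 candidate claims about `∇(E) = Sing(𝔜(t))` AS HYPOTHESIS FIELDS, and the
  `Inv`-reading slot `invY` of row 019. EXISTENCE NOT SHOWN IN PRINT (row 091 `U78L2`); a résumé is DATA a statement
  quantifies over, never something this file constructs. `Resume.nabla` (= `∇(E)` as a `Closeds`, closedness from the
  hypothesis field), `Resume.m` (number of stops, DESIGN POINT M), `Resume.mti` (the row-019 résumé via the landed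
  bridge `MTIDatum.ofARSchemes`), `Resume.invStr` (the `Inv`-string of Eq. (127) at a point).
* `Reading N` + `readingR1/R2/R3` — which function of the résumé `Inv_ξ(𝒴(i))` is (GAP-LEDGER R16; row 019c's three
  predicates instantiated at the résumé's OWN sequence data `E(s+1)` / `Ě(s)`).
* `IsCentre R D` — THE CENTRE RULE, literal reading of p.84 l.4–6 («`D` any smooth closed irreducible subscheme of
  `∇(E)`»; `S16Proof.Thm16_6`); `IsCentrePermE` — the sibling reading «permissible FOR `E`» (`Thm16_6_permE`); under the
  résumé's Def. 15.12 inclusion hypotheses the literal rule already gives a §2.1-permissible centre for `E`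
  (`IsCentre.isPermissibleCentre`, companion module).
* `Step R A'` — ONE STEP: a centre admitted by the rule and the blow-up `π : A'.Z ⟶ A.Z` along it onto the next ambient
  datum `A'` (same base field: `A'.hom = π ≫ A.hom`); `Step.E'` = the transform of `E` (Def. 2.1, row 001).
* `Decrease s R'` / `LengthLe s R'` — Eq. (127) and «m′ ≤ m» FOR THE STEP `s`, reading R (the primed résumé is a résumé
  `R'` of the transform `E′`, «core-edge focusing is renewed» p.87 l.18): literally row 019's `Thm16_6_2` / `Thm16_6_2_mle`
  at `S := R.mti`, `S′ := fun _ => R'.mti`. `DecreaseT` — the same for reading T (member-wise transform, row 019c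
  `MTIDatum.transformT`; one step only, it does not iterate).
* `Regime` (+ `Regime.top`, `.dimLE`, `.cartier`, `.charGT`, `.inter`) — restriction predicates on the state `(A, E)`;
  the four W4.6 regimes themselves are fixed by res-L1-s46-plan-1 in the rung files (candidates recorded below).
* `DecreaseAlongSteps N Rd Rg` — «every step permitted by the typed centre rule from a state in regime `Rg` makes the
  typed `Inv`-string strictly decrease at the closed points over the centre off `D′`, and `m′ ≤ m`» (the shape the
  rungs `Campaign.Thm16_6_2_ours_<regime>` instantiate; s47's negations deny instances of it).
* `Run N Rd` / `Terminates N Rd Rg` — an INFINITE run of the procedure (résumé posited at every stage) / «no infinite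
  run all of whose stages lie in `Rg`» = «hence terminates».
* `Diverges`, `RunFrom N Rd A₀ E₀` (+ `consA`, `RunFrom.toRun`), `DivergesFrom N Rd Rg A₀ E₀` — the NEGATIVE-SIDE shapes
  (W4.7): an infinite run (from a given initial state) inside a regime; `Campaign.TypedProcedureDiverges_<family>` :=
  `DivergesFrom` at the family's initial datum.
* `primeR N Rd` — the instance of row 019's relation parameter `prime` that reading R denotes; with it the companion
  module proves `decreaseAlongSteps_of_thm16_6`: each rung is the typed candidate `S16Proof.Thm16_6` — `prime` read as
  «the primed résumés are résumés of `E′`» — RESTRICTED to the regime (proving a rung banks what the architecture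
  achieves there; refuting one refutes that reading of the candidate there, nothing more). `Run.tail` — shift of a run.

## DESIGN POINTS for res-L1-s46-plan-1 / res-L1-s47-plan-1 and the OURS lanes (each a CHOICE; none takes a side)

* (M) `Resume.m := t` (the terminal index): «the actual number `m` of stops before reaching the terminal» (p.84 l.17)
  read as `𝒴(0), …, 𝒴(m−1)` strictly before the terminal stage `𝒴(t)` of (126). Alternative `m := t + 1`.
* (Y′) Reading of the primed résumé (GAP-LEDGER ★R10 (A)): runs ITERATE, so `Run`/`Terminates`/`DecreaseAlongSteps` use
  reading R (résumé of `E′`); reading T is offered for one step (`DecreaseT`). The rung files say which they assert.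
* (LOC) «Locally at every point `ξ′`» (p.84 l.10): here ONE résumé `R′` of `E′` on all of `Z′` is compared at every
  point of the locus (constant family `fun _ => R'.mti`); a germ-wise variant (résumés of `E′` restricted to open
  neighbourhoods of `ξ′`) is NOT typed here — ask and it is one more decl.
* (LOCUS) the points of Eq. (127) are row 019's: `ξ′` closed, `π ξ′ ∈ D`, `ξ′ ∉ D′ = ∇′ ∩ π⁻¹(D)` (`MTIDatum.DPrime`);
  the brief's wording «π⁻¹(∇) ∖ ∇′» is row 096's `Cor16_9_ours` locus (adj-4 DOSSIER §2 `LocusAgree`).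
* (INV) the `Inv`-reading is the parameter `Rd : Reading N`; `readingR1` (member-wise), `readingR2` (`Inv` of `E(s+1)`),
  `readingR3` (`Inv` of `Ě(s)`) are supplied; a rung names one.
* (CTR) centre rule literal (`IsCentre`, as `Thm16_6`) — the permE sibling is implied under the résumé's Def. 15.12
  hypotheses (`IsCentre.isPermissibleCentre`), so runs are typed with the literal rule only.
* (REG) a regime is a predicate on `(A, E)` required AT EVERY STAGE of a run (brief: «state the window as a hypothesis
  on EVERY step, not only the first»). Candidates for the rung files: (i) `Regime.dimLE 2` [plane-curve exponents,
  K4.6's family] or `dimLE 3 ⊓ cartier`; (ii) `dimLE 3 ⊓ cartier` read at `dim = 3` resp. ambient fourfolds — plan-1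
  decides what «threefold hypersurfaces» means (`X` or `Z` three-dimensional); (iii) Moh window `z^p = f`, `ord f < 2p`
  — needs a local normal-form predicate (regular parameter `z`, `f` free of `z`): NOT typed here; (iv)
  `Regime.charGT n f` with `f` EXPLICIT (brief: first candidate the `DirectrixSmallCharacteristicNarrow_holds`
  threshold, i.e. `f n b = 2 * n` for «p ≥ dim/2 + 1»-type bounds — plan-1 fixes `f`).
* (VAC) VACUITY, stated once for all Props below: `DecreaseAlongSteps`/`Terminates` quantify over résumés and runs whose
  EXISTENCE the typed rows posit but do not construct (`U78L2`, Def. 15.8), relative to notion parameters `N` that the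
  rows leave abstract; for the INTENDED instances (rows 006/007/010/015/026/027) they are neither provable nor
  refutable by bookkeeping alone (a proof of `Terminates` must use the blow-up structure; a proof that never touches
  `Step.blowup` signals a vacuous instance and must be reported as such); for JUNK instances of `N` (e.g. `coreFocus :=
  ⊤`) résumés with arbitrary smooth `∇ ⊆ Sing(E)` exist and `Terminates N Rd ⊤` is refutable by point blow-ups along a
  singular curve — so NO campaign statement may quantify over all `N`; each names its instance.

## References

* plan/SIZED-ASK-L.md v0.2 §S S-s46 / S-s47, §U (res-plan-2, 2026-08-26T18:28:17Z); plan/RESCUE-SEED.md §1 rows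
  W4.6/W4.7; HOME/ledger/group-4/DOSSIER.md §2 ★R10, §3 (readings T/R; index only).
* H. Hironaka, ms. 2017-03-23: Th. 16.6 p.84 l.4–32; §16.3 p.87 l.11–25; Rem. 16.2 p.81 l.17–30; Def. 15.8 p.78;
  Def. 15.11/15.12 p.80 l.29 – p.81 l.4; §2 p.4 l.22–24, §2.1 p.4 l.37–39, Def. 2.1 p.5 — quoted for scope only, under
  adjudication, not cited as fact. [Hironaka2017]
-/

noncomputable section

set_option linter.dupNamespace false -- mandated namespace of this single-conjunct summit

open CategoryTheory AlgebraicGeometry TopologicalSpace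

namespace Summit.ResolutionOfSingularities.ResolutionOfSingularities.Theorems

namespace CampaignW46

open Literature.AlgebraicGeometry.Resolution
open Literature.AlgebraicGeometry.Hironaka2017.S02Preliminaries
open Literature.AlgebraicGeometry.Hironaka2017.Datum
open Literature.AlgebraicGeometry.Hironaka2017.S15ARSchemes
open Literature.AlgebraicGeometry.Hironaka2017.S16Proof

universe u

/-! ## Notion parameters (rows 006/007/010/015/026/027/087, scheme-polymorphic) -/

/-- [OURS · L1 W4.6/W4.7] NOT a statement of the manuscript. The notion parameters of the rung-S carriers
`S15ARSchemes.YStep`/`YSequence` (Def. 15.8 p.78) and `S16Proof.InvReadingR1` (Eq. (34) p.24), bundled in one record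
and quantified over ALL schemes of the universe (a run of the procedure changes the ambient scheme at each blow-up):
`arRed` «⇁» (Def. 3.11), `arEq` «⇌» (Eq. (14)), `inSOn` «∈ 𝔖(F(Y))» for an exponent on a closed `Y`, `coreFocus Ê Ě`
(Eqs. (43)/(44) p.30), `IsCotGen F ℓ U S` (cotangential generators of `Cot(F)(U)` as `ρ^ℓ(𝒪)`-module, Def. 15.8 (3)),
`vrank F ξ = rank 𝔳(F)_ξ` (Eq. (124)), `inv F ξ = Inv_ξ(F)` (Eq. (34)). Rendering choice: the rows take these one
by one as explicit parameters over a fixed ambient; nothing about their meaning is decided here. [folklore] -/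
structure Notions (n : ℕ) : Type (u + 1) where
  /-- AR-reduction «⇁» (Def. 3.11 p.13; row 026) -/
  arRed : ARRel.{u}
  /-- AR-equivalence «⇌» (Eq. (14) p.13; row 027) -/
  arEq : ARRel.{u}
  /-- «`L ∈ 𝔖(F(Y))`» for an ideal exponent on a closed `Y ⊆ V` (Def. 3.11/3.12; row 026) -/
  inSOn : SOnRel.{u}
  /-- «`Ě` is a core-edge focusing of `Ê`» (Eqs. (43)/(44) p.30; row 010) -/
  coreFocus : ∀ {W : Scheme.{u}}, IdealExponent W → IdealExponent W → Prop
  /-- cotangential generators (Def. 15.8 (3) p.78; rows 015/087) -/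
  IsCotGen : ∀ {W : Scheme.{u}}, IdealExponent W → ℕ → ∀ U : W.Opens, Set Γ(W, U) → Prop
  /-- `rank 𝔳(F)_ξ` (Eq. (124) p.78; row 006) -/
  vrank : ∀ {W : Scheme.{u}}, IdealExponent W → W → ℕ
  /-- `Inv_ξ(F)` with values in the tree's `Datum.EdgeInv n` (Eq. (34) p.24; row 007) -/
  inv : ∀ {W : Scheme.{u}}, IdealExponent W → W → EdgeInv n

variable {n : ℕ} {p : ℕ} [Fact p.Prime] {K : Type u} [Field K] [CharP K p]

/-! ## The résumé of `E` (Def. 15.8 / Eq. (123), Def. 15.11 / 15.12, rows 091/094; row 019's `MTIDatum`) -/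

/-- [OURS · L1 W4.6/W4.7] replaces the role of «the résumé of `E`» that Th. 16.6 p.84 l.4–20 quantifies over (`∇(E)`,
`𝒴(0), …, 𝒴(m−1)`, `Inv_ξ(𝒴(i))`); NOT a statement of the manuscript. DATA, relative to `N : Notions n`, on the ambient
datum `A` (§2 p.4 l.22–24) for the ideal exponent `E`: a 𝔜-sequence (123) `E = E(0) ⇛ …` (row 091 `YSequence`;
Def. 15.8 p.78, each step positing `Ě(s)`, the AR-scheme `𝔜(s)`, `E(s+1)`, with «`J(s) ≠ (0)`, `b(s) > 0`»), a terminal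
index (Def. 15.11 p.80 l.29–33, row 094 `YTerminal`: first stage at which every member has `℘` generated in degree
one), the two Def. 15.12 candidate claims (p.80 l.37 – p.81 l.2) about the terminal plat `∇(E) = Sing(𝔜(t))` AS
HYPOTHESES — «smooth closed non-empty» (`YSequence.Def15_12_smoothAt`) and «`∇(E) ⊆ Sing(Ě)`, `Sing(Ě) ⊆ Sing(E)`»
(`YSequence.Def15_12_inclAt`) —, and row 019's READING SLOT `invY i ξ = Inv_ξ(𝒴(i))`. EXISTENCE NOT SHOWN IN PRINT
(row 091 `U78L2`): statements quantify over résumés; this file never constructs one. [folklore] -/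
structure Resume (N : Notions.{u} n) (A : AmbientDatum p K) (E : IdealExponent A.Z) where
  /-- the 𝔜-sequence (123) of `E` (Def. 15.7/15.8 pp.77–78; row 091) -/
  𝒴 : YSequence A N.arRed N.arEq N.inSOn N.coreFocus N.IsCotGen N.vrank n E
  /-- its terminal index `t` (Def. 15.11 p.80 l.29–33; row 094) -/
  T : 𝒴.Terminal
  /-- HYPOTHESIS (typed candidate, Def. 15.12 p.80 l.37–38): `∇(E)` «is smooth closed non-empty subscheme of `Z`» -/
  nabla_smooth : 𝒴.Def15_12_smoothAt T
  /-- HYPOTHESIS (typed candidate, Def. 15.12 p.80 l.38 – p.81 l.2): `∇(E) ⊆ Sing(Ě(0))` and `Sing(Ě(0)) ⊆ Sing(E)` -/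
  nabla_incl : 𝒴.Def15_12_inclAt T
  /-- READING SLOT «`Inv_ξ(𝒴(i))`» (Eq. (127) p.84 l.11–16; row 019 `MTIDatum.invY`), pinned by a `Reading` -/
  invY : ℕ → A.Z → EdgeInv n

namespace Resume

variable {N : Notions.{u} n} {A : AmbientDatum p K} {E : IdealExponent A.Z} (R : Resume N A E)

/-- [OURS · L1 W4.6/W4.7] «`∇ = ∇(E)`» (p.81 l.2–4; p.84 l.5) as a closed subset of `Z`: the terminal plat
`Sing(𝔜(t))` of the résumé (row 094 `YSequence.nabla`), closed by the first component of the hypothesis field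
`nabla_smooth` (row 093 `IsSmoothClosedNonempty`). NOT a statement of the manuscript. [folklore] -/
def nabla : Closeds A.Z :=
  ⟨R.𝒴.nabla R.T, by
    have h : IsSmoothClosedNonempty A.hom (R.𝒴.nabla R.T) := R.nabla_smooth
    obtain ⟨hc, -⟩ := h
    exact hc⟩

/-- [OURS · L1 W4.6/W4.7] DESIGN POINT (M): «the actual number `m` of stops before reaching the terminal» (p.84 l.17)
:= the terminal index `t` of Def. 15.11 (strings run over `𝒴(0), …, 𝒴(t−1)`). NOT a statement of the manuscript.
[folklore] -/
def m : ℕ :=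
  R.T.t

/-- [OURS · L1 W4.6/W4.7] The row-019 résumé (`S16Proof.MTIDatum`, the hypothesis bundle of the typed `Thm16_6`) OF
THIS résumé, through the landed bridge `MTIDatum.ofARSchemes` (row 019c: members of `𝒴(i)` = the `F_j` of the
AR-scheme `𝔜(i)` together with the AR-extensions `H_{ji}`, Def. 15.1 (6) p.75), with `∇ := R.nabla`, `m := R.m` and the
reading slot `R.invY`. NOT a statement of the manuscript. [folklore] -/
def mti : MTIDatum A.Z n :=
  MTIDatum.ofARSchemes A E (fun i => (R.𝒴.step i).𝒴) R.nabla R.m R.invY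

/-- [OURS · L1 W4.6/W4.7] The `Inv`-string `(Inv_ξ(𝒴(0)), …, Inv_ξ(𝒴(m−1)))` of Eq. (127)/(128) p.84 l.11–16 at `ξ`
(row 019 `MTIDatum.invStr` at length `m`). NOT a statement of the manuscript. [folklore] -/
def invStr (ξ : A.Z) : List (EdgeInv n) :=
  R.mti.invStr R.m ξ

end Resume

/-! ## The `Inv`-reading (GAP-LEDGER R16; row 019c's `InvReadingR1/R2/R3`) -/

/-- [OURS · L1 W4.6/W4.7] An `Inv`-READING: a predicate on résumés pinning the slot `invY` («`Inv_ξ(𝒴(i))`», Eq. (127),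
defined in print for ONE ideal exponent only, Eq. (34) p.24). NOT a statement of the manuscript. [folklore] -/
def Reading (p : ℕ) [Fact p.Prime] (K : Type u) [Field K] [CharP K p] (N : Notions.{u} n) : Type (u + 1) :=
  ∀ (A : AmbientDatum p K) (E : IdealExponent A.Z), Resume N A E → Prop

/-- [OURS · L1 W4.6/W4.7] Reading R1 (member-wise, p.86 l.9–11): row 019c's `InvReadingR1 N.inv` at the résumé's
`MTIDatum`. NOT a statement of the manuscript. [folklore] -/
def readingR1 (N : Notions.{u} n) : Reading p K N :=
  fun _ _ R => InvReadingR1 N.inv R.mti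

/-- [OURS · L1 W4.6/W4.7] Reading R2 (`Inv_ξ(𝒴(s)) = Inv_ξ(E(s+1))`, Def. 15.8 (1) p.78): row 019c's `InvReadingR2 N.inv`
with `Eseq :=` the résumé's own `E(s)` (row 091 `YSequence.E_`). NOT a statement of the manuscript. [folklore] -/
def readingR2 (N : Notions.{u} n) : Reading p K N :=
  fun _ _ R => InvReadingR2 N.inv R.𝒴.E_ R.mti

/-- [OURS · L1 W4.6/W4.7] Reading R3 (`Inv_ξ(𝒴(s)) = Inv_ξ(Ě(s))`, Def. 15.8 p.78 L15): row 019c's `InvReadingR3 N.inv`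
with `Echeck s :=` the résumé's own `Ě(s)` (row 091 `YStep.Echeck`). NOT a statement of the manuscript. [folklore] -/
def readingR3 (N : Notions.{u} n) : Reading p K N :=
  fun _ _ R => InvReadingR3 N.inv (fun s => (R.𝒴.step s).Echeck) R.mti

/-! ## The centre rule (Th. 16.6 p.84 l.4–6; Rem. 16.2 (1) p.81 l.17–22) -/

section Centre

variable {N : Notions.{u} n} {A : AmbientDatum p K} {E : IdealExponent A.Z}

/-- [OURS · L1 W4.6/W4.7] replaces the role of the centre rule of Th. 16.6, p.84 l.4–6 «Let `D` be any smooth closed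
irreducible subscheme of `∇(E)` such that the blowup `π : Z′ → Z` with center `D` is permissible», LITERAL reading (as
the typed `S16Proof.Thm16_6`: `D ⊆ ∇(E)` closed, irreducible, smooth over `K` through the reduced structure `V(𝓘_D)`;
«permissible» left unqualified, as printed); NOT a statement of the manuscript. [folklore] -/
structure IsCentre (R : Resume N A E) (D : Closeds A.Z) : Prop where
  /-- «subscheme of `∇(E)`» -/
  subset_nabla : (D : Set A.Z) ⊆ (R.nabla : Set A.Z)
  /-- «irreducible» -/
  irreducible : IsIrreducible (D : Set A.Z)
  /-- «smooth» (over the base field `K`, reduced structure `V(𝓘_D)`) -/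
  smooth : Smooth ((Scheme.IdealSheafData.vanishingIdeal D).subschemeι ≫ A.hom)

/-- [OURS · L1 W4.6/W4.7] the same rule in the SIBLING reading «permissible FOR `E`» (typed `S16Proof.Thm16_6_permE`;
§2.1 p.4 l.37–39, row 001 `IdealExponent.IsPermissibleCentre`: irreducible, smooth over `K`, `D ⊆ Sing(E)`), together
with `D ⊆ ∇(E)`; NOT a statement of the manuscript. [folklore] -/
def IsCentrePermE (R : Resume N A E) (D : Closeds A.Z) : Prop :=
  (D : Set A.Z) ⊆ (R.nabla : Set A.Z) ∧ E.IsPermissibleCentre A.hom D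

end Centre

/-! ## One step of the procedure and Eq. (127) for it (Th. 16.6 (2), p.84 l.10–20) -/

/-- [OURS · L1 W4.6/W4.7] ONE STEP of the typed procedure from the state `(A, E, R)` — replaces the role of «the blowup
`π : Z′ → Z` with center `D`» of Th. 16.6 p.84 l.5–6 iterated as in §16.3 p.87 l.14–17; NOT a statement of the
manuscript. Data: a centre `D` admitted by the literal rule (`IsCentre`), the next ambient datum `A'` over the SAME base
field (`A'.hom = π ≫ A.hom`; that the blow-up of the smooth irreducible `Z` along a smooth irreducible centre is again an
ambient datum is thereby a hypothesis, not a claim), and the blowing up `π : A'.Z ⟶ A.Z` along the reduced ideal of `D`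
(tree `Resolution.IsBlowup`). [folklore] -/
structure Step {N : Notions.{u} n} {A : AmbientDatum p K} {E : IdealExponent A.Z} (R : Resume N A E)
    (A' : AmbientDatum p K) where
  /-- the centre `D` (p.84 l.5) -/
  D : Closeds A.Z
  /-- admitted by the centre rule -/
  centre : IsCentre R D
  /-- the blow-up morphism onto the next ambient scheme -/
  π : A'.Z ⟶ A.Z
  /-- same base field: the structure morphism of `A'` factors through `π` -/
  hom_eq : A'.hom = π ≫ A.hom
  /-- `π` is the blowing up of `Z` along (the reduced ideal sheaf of) `D` -/
  blowup : IsBlowup π (Scheme.IdealSheafData.vanishingIdeal D)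

namespace Step

variable {N : Notions.{u} n} {A A' : AmbientDatum p K} {E : IdealExponent A.Z} {R : Resume N A E} (s : Step R A')

/-- [OURS · L1 W4.6/W4.7] the transform `E′` of `E` by the step (Def. 2.1 p.5, row 001 `IdealExponent.transform`:
controlled transform, same exponent); NOT a statement of the manuscript. [folklore] -/
def E' : IdealExponent A'.Z :=
  E.transform s.π s.D

/-- Eq. (127) FOR THE STEP `s`, reading R — the consequence-shape of Th. 16.6 (2) p.84 l.10–20 that the W4.6 rungs
assert in restricted regimes and the W4.7 negations deny at a family: for a résumé `R′` of the transform `E′` on `A′`,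
at every closed `ξ′` with `π ξ′ ∈ D` and `ξ′ ∉ D′ = ∇′ ∩ π⁻¹(D)` (`∇′` = strict transform of `∇`), the `Inv`-string of
`R′` at `ξ′` is `<_lex` (0-padded, `InvString.LexLT`) the `Inv`-string of `R` at `π ξ′` — LITERALLY row 019's
`Thm16_6_2 R.mti s.π s.D (fun _ => R'.mti)`. OURS instantiation; NOT a statement of the manuscript and not asserted;
it carries the claim tag only because its content is the consequence-shape of a claim under review.
[claim: Hironaka2017, status: under-review] -/
def Decrease (R' : Resume N A' s.E') : Prop :=
  Thm16_6_2 R.mti s.π s.D (fun _ => R'.mti)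

/-- «that is to say `m′ ≤ m`» (p.84 l.17–18) FOR THE STEP `s`, reading R: row 019's `Thm16_6_2_mle` at the same data.
OURS instantiation; not asserted. [claim: Hironaka2017, status: under-review] -/
def LengthLe (R' : Resume N A' s.E') : Prop :=
  Thm16_6_2_mle R.mti s.π s.D (fun _ => R'.mti)

/-- Eq. (127) FOR THE STEP `s`, reading T (DESIGN POINT (Y′); «replacing 𝔜's by their transforms» p.87 l.16): the primed
résumé is the member-wise transform `R.mti.transformT s.π s.D m' invY'` of row 019c, for a number of stops `m′` and a
primed `Inv`-slot `invY′` (to be pinned by an `InvReadingRk` predicate by whoever asserts this). One step only — the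
transform of a résumé is not a résumé of `E′` in the sense of `Resume`, so this reading does not iterate. OURS
instantiation; not asserted. [claim: Hironaka2017, status: under-review] -/
def DecreaseT (m' : ℕ) (invY' : ℕ → A'.Z → EdgeInv n) : Prop :=
  Thm16_6_2 R.mti s.π s.D (fun _ => R.mti.transformT s.π s.D m' invY')

end Step

/-! ## Regimes (restriction predicates on the state) -/

/-- [OURS · L1 W4.6] A REGIME: a predicate on the state `(A, E)` of the procedure (ambient datum, current ideal
exponent), imposed at every stage (DESIGN POINT (REG)). NOT a statement of the manuscript. [folklore] -/
def Regime (p : ℕ) [Fact p.Prime] (K : Type u) [Field K] [CharP K p] : Type (u + 1) :=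
  ∀ (A : AmbientDatum p K), IdealExponent A.Z → Prop

namespace Regime

/-- [OURS] the unrestricted regime (W4.7's «`Campaign.Thm16_6_2_ours_<unrestricted>`»). [folklore] -/
def top : Regime p K :=
  fun _ _ => True

/-- [OURS] ambient dimension at most `d` (`topologicalKrullDim Z ≤ d`, the host item's idiom,
`MarkedTransfer.HypersurfaceOrderReductionDimLeThree`). Candidate for regimes (i)/(ii). [folklore] -/
def dimLE (d : ℕ) : Regime p K :=
  fun A _ => topologicalKrullDim A.Z ≤ (d : WithBot ℕ∞)

/-- [OURS] hypersurface exponents: the ideal of `E = (J, b)` is effective Cartier (tree `Resolution.IsEffectiveCartier`,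
the host crux `MarkedTransfer.HypersurfaceOrderReduction`'s idiom). Candidate conjunct for regimes (i)/(ii). [folklore] -/
def cartier : Regime p K :=
  fun _ E => IsEffectiveCartier E.J

/-- [OURS] large characteristic relative to dimension and exponent: `f n b < p` for an EXPLICIT `f` (regime (iv); the
brief forbids `∃ f`). [folklore] -/
def charGT (n : ℕ) (f : ℕ → ℕ → ℕ) : Regime p K :=
  fun _ E => f n E.b < p

/-- [OURS] conjunction of two regimes. [folklore] -/
def inter (R₁ R₂ : Regime p K) : Regime p K :=
  fun A E => R₁ A E ∧ R₂ A E

end Regime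

/-! ## The campaign shapes: decrease along every permitted step; no infinite run -/

/-- [OURS · L1 W4.6/W4.7] THE ONE-STEP SHAPE the rungs `Campaign.Thm16_6_2_ours_<regime>` instantiate — replaces the role of
Th. 16.6 (2) / Eq. (127) p.84 l.10–20 restricted to a regime; NOT a statement of the manuscript. For every state
`(A, E, R)` with `E` in the regime `Rg` and the résumé read by `Rd`, every step `s` permitted by the typed centre rule,
and every résumé `R′` of the transform `E′` read by `Rd`: Eq. (127) holds at the closed points over the centre off `D′`
and `m′ ≤ m` (`Step.Decrease`, `Step.LengthLe`). VACUITY: see module docstring (VAC) — contentful exactly for the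
intended notion instances; for `Rg := Regime.top` it is the (2)-part of the typed candidate under reading R
(`decreaseAlongSteps_of_thm16_6`). [folklore] -/
def DecreaseAlongSteps (N : Notions.{u} n) (Rd : Reading p K N) (Rg : Regime p K) : Prop :=
  ∀ (A : AmbientDatum p K) (E : IdealExponent A.Z) (R : Resume N A E), Rg A E → Rd A E R →
    ∀ (A' : AmbientDatum p K) (s : Step R A') (R' : Resume N A' s.E'), Rd A' s.E' R' →
      s.Decrease R' ∧ s.LengthLe R'

/-- [OURS · L1 W4.6/W4.7] AN INFINITE RUN of the typed procedure (§16.3 p.87 l.14–17 «we apply Th.(16.6) … repeatedly»),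
relative to `N` and the reading `Rd`: ambient data `A k` over the same `K`, ideal exponents `E k` with
`E (k+1) = ` the transform by step `k`, a résumé `R k` of EVERY `E k` (posited), read by `Rd`, and a permitted step at
every `k`. A candidate divergent family of W4.7 is an inhabitant of this type (in a regime); NOT a statement of the
manuscript. ROLE WITHDRAWN (v3, 2026-08-26, res-L1-s47-dis-1 D1 / OURS lane A 21:02Z): with the LITERAL sub-centre rule this is the
WEAK notion — refutable, modulo résumé existence, by point towers that never touch a singular curve — and it NO LONGER replaces the
role of any printed item; the manuscript's «∇ blowups» procedure (§16.2 title p.84 l.2, Th. 16.6 (4), Rem. 16.2 (2)) is the ∇-CENTRED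
notion `RunNabla` of the section «∇-centred runs» below. Kept (Lean term unchanged) as the ambient type the ∇-centred notions refine. [folklore] -/
structure Run (N : Notions.{u} n) (Rd : Reading p K N) where
  /-- the ambient datum at stage `k` (`Z_k` smooth irreducible of finite type over `K`) -/
  A : ℕ → AmbientDatum p K
  /-- the ideal exponent at stage `k` -/
  E : ∀ k, IdealExponent (A k).Z
  /-- a résumé of `E k` on `A k` (EXISTENCE posited at every stage) -/
  R : ∀ k, Resume N (A k) (E k)
  /-- every résumé is read by `Rd` -/
  reads : ∀ k, Rd (A k) (E k) (R k)
  /-- the step `Z_{k+1} → Z_k` permitted by the centre rule at the résumé `R k` -/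
  step : ∀ k, Step (R k) (A (k + 1))
  /-- `E_{k+1}` is the transform of `E_k` by step `k` (Def. 2.1) -/
  E_succ : ∀ k, E (k + 1) = (step k).E'

/-- [OURS · L1 W4.6/W4.7] «HENCE TERMINATES» — replaces the role of the termination half of Th. 16.13 p.87 l.26–28
(«repeatedly but finitely many times») for the typed procedure restricted to a regime: there is NO infinite run all of
whose stages lie in `Rg`. NOT a statement of the manuscript. VACUITY: module docstring (VAC); note also that a run
can only continue while the centre rule admits a centre, i.e. while `∇(E_k)` is non-empty — by the résumé's Def. 15.12
hypothesis it always is, so «the procedure stops because `Sing` became empty» shows as «no résumé of a resolved `E`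
exists», which is how Def. 15.12 «non-empty … ⊆ Sing(E)» reads. ROLE WITHDRAWN (v3, 2026-08-26, res-L1-s47-dis-1 D1 / OURS lane A 21:02Z): with the LITERAL sub-centre rule this is the
WEAK notion — refutable, modulo résumé existence, by point towers that never touch a singular curve — and it NO LONGER replaces the
role of any printed item; the manuscript's «∇ blowups» procedure (§16.2 title p.84 l.2, Th. 16.6 (4), Rem. 16.2 (2)) is the ∇-CENTRED
notion `TerminatesNabla` of the section «∇-centred runs» below. Kept (Lean term unchanged) as the ambient type the ∇-centred notions refine. [folklore] -/
def Terminates (N : Notions.{u} n) (Rd : Reading p K N) (Rg : Regime p K) : Prop :=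
  ∀ r : Run N Rd, (∀ k, Rg (r.A k) (r.E k)) → False

/-! ## Divergence shapes for the negative side (W4.7: «a divergent family for the TYPED procedure») -/

/-- [OURS · L1 W4.7] «the typed procedure DIVERGES somewhere in the regime»: there IS an infinite run all of whose stages
lie in `Rg` — the plain negation-side of `Terminates` (`Terminates N Rd Rg ↔ ¬ Diverges N Rd Rg`, companion module).
NOT a statement of the manuscript. ROLE WITHDRAWN (v3, 2026-08-26, res-L1-s47-dis-1 D1 / OURS lane A 21:02Z): with the LITERAL sub-centre rule this is the
WEAK notion — refutable, modulo résumé existence, by point towers that never touch a singular curve — and it NO LONGER replaces the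
role of any printed item; the manuscript's «∇ blowups» procedure (§16.2 title p.84 l.2, Th. 16.6 (4), Rem. 16.2 (2)) is the ∇-CENTRED
notion `DivergesNabla` of the section «∇-centred runs» below. Kept (Lean term unchanged) as the ambient type the ∇-centred notions refine. [folklore] -/
def Diverges (N : Notions.{u} n) (Rd : Reading p K N) (Rg : Regime p K) : Prop :=
  ∃ r : Run N Rd, ∀ k, Rg (r.A k) (r.E k)

/-- [OURS · L1 W4.7] bookkeeping for runs FROM A GIVEN STATE: the stage sequence `A₀, A 0, A 1, …` (stage `0` is the
given ambient datum DEFINITIONALLY, so that an initial ideal exponent `E₀` on `A₀.Z` typechecks at stage `0`). [folklore] -/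
def consA (A₀ : AmbientDatum p K) (A : ℕ → AmbientDatum p K) : ℕ → AmbientDatum p K
  | 0 => A₀
  | k + 1 => A k

/-- [OURS · L1 W4.7] AN INFINITE RUN FROM THE STATE `(A₀, E₀)` — the shape of a «candidate divergent family for the TYPED
procedure» (S-s47 `Campaign.TypedProcedureDiverges_<family>` := `DivergesFrom` at the family's initial datum, in the
regime the family lives in): as `Run`, with stage `0` pinned to `A₀` and `E 0 = E₀`. Résumés posited at every stage,
read by `Rd`. NOT a statement of the manuscript. ROLE WITHDRAWN (v3, 2026-08-26, res-L1-s47-dis-1 D1 / OURS lane A 21:02Z): with the LITERAL sub-centre rule this is the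
WEAK notion — refutable, modulo résumé existence, by point towers that never touch a singular curve — and it NO LONGER replaces the
role of any printed item; the manuscript's «∇ blowups» procedure (§16.2 title p.84 l.2, Th. 16.6 (4), Rem. 16.2 (2)) is the ∇-CENTRED
notion `RunFromNabla` of the section «∇-centred runs» below. Kept (Lean term unchanged) as the ambient type the ∇-centred notions refine. [folklore] -/
structure RunFrom (N : Notions.{u} n) (Rd : Reading p K N) (A₀ : AmbientDatum p K) (E₀ : IdealExponent A₀.Z) where
  /-- the ambient data of stages `1, 2, …` -/
  Asucc : ℕ → AmbientDatum p K
  /-- the ideal exponent at stage `k` (stage `0` lives on `A₀.Z`) -/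
  E : ∀ k, IdealExponent (consA A₀ Asucc k).Z
  /-- the run starts at `E₀` -/
  E_zero : E 0 = E₀
  /-- a résumé of every stage (EXISTENCE posited) -/
  R : ∀ k, Resume N (consA A₀ Asucc k) (E k)
  /-- every résumé is read by `Rd` -/
  reads : ∀ k, Rd (consA A₀ Asucc k) (E k) (R k)
  /-- the step from stage `k` to stage `k + 1`, permitted by the centre rule -/
  step : ∀ k, Step (R k) (consA A₀ Asucc (k + 1))
  /-- `E_{k+1}` is the transform of `E_k` -/
  E_succ : ∀ k, E (k + 1) = (step k).E'

/-- [OURS · L1 W4.7] forgetting the initial state: a run from `(A₀, E₀)` is a run. [folklore] -/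
def RunFrom.toRun {N : Notions.{u} n} {Rd : Reading p K N} {A₀ : AmbientDatum p K} {E₀ : IdealExponent A₀.Z}
    (r : RunFrom N Rd A₀ E₀) : Run N Rd where
  A := consA A₀ r.Asucc
  E := r.E
  R := r.R
  reads := r.reads
  step := r.step
  E_succ := r.E_succ

/-- [OURS · L1 W4.7] «the typed procedure admits an infinite run starting from `(A₀, E₀)` all of whose stages lie in `Rg`»
— the statement shape of a candidate divergent family (a W4.7 `Campaign.TypedProcedureDiverges_<family>` is this at the
family's initial datum; its proof must EXHIBIT résumés at every stage, which is where the typed §15 carriers are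
consumed). NOT a statement of the manuscript. VACUITY: unprovable for junk reasons exactly when no résumé of `E₀` exists
under `N` — a divergence proof therefore certifies non-vacuity of the rung it kills. ROLE WITHDRAWN (v3, 2026-08-26, res-L1-s47-dis-1 D1 / OURS lane A 21:02Z): with the LITERAL sub-centre rule this is the
WEAK notion — refutable, modulo résumé existence, by point towers that never touch a singular curve — and it NO LONGER replaces the
role of any printed item; the manuscript's «∇ blowups» procedure (§16.2 title p.84 l.2, Th. 16.6 (4), Rem. 16.2 (2)) is the ∇-CENTRED
notion `DivergesFromNabla` of the section «∇-centred runs» below. Kept (Lean term unchanged) as the ambient type the ∇-centred notions refine. [folklore] -/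
def DivergesFrom (N : Notions.{u} n) (Rd : Reading p K N) (Rg : Regime p K) (A₀ : AmbientDatum p K)
    (E₀ : IdealExponent A₀.Z) : Prop :=
  ∃ r : RunFrom N Rd A₀ E₀, ∀ k, Rg (consA A₀ r.Asucc k) (r.E k)

/-! ## The reading-R instance of row 019's `prime` parameter; shifting a run -/

/-- [OURS · L1 W4.6/W4.7] The instance of row 019's relation parameter `prime` of `S16Proof.Thm16_6` that reading R
denotes: the local primed résumés `S′ ξ′` all equal the row-019 résumé of SOME résumé `R′` (read by `Rd`) of the
transform of `S.E`, on SOME ambient-datum structure of `Z′` over `K`. (Row 019's `prime` sees only `S, π, D, S′`, not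
the structure morphism of `Z`, whence the existential over `Z′ ⟶ Spec K`; this makes `Thm16_6 n (primeR N Rd) _` a
priori STRONGER than what runs use, which is the direction the anchor `decreaseAlongSteps_of_thm16_6` of the
companion module `MarkedTransferCampaignW46TypedProcedureAnchors` needs.) NOT a statement of the manuscript.
[folklore] -/
def primeR (N : Notions.{u} n) (Rd : Reading p K N) :
    ∀ {Z Z' : Scheme.{u}}, MTIDatum Z n → (Z' ⟶ Z) → Closeds Z → (Z' → MTIDatum Z' n) → Prop :=
  fun {_ Z'} S π D S' =>
    ∃ (f' : Z' ⟶ Spec (.of K)) (hirr : IrreducibleSpace Z') (hsm : Smooth f') (hqc : QuasiCompact f')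
      (R' : Resume N (⟨Z', f', hirr, hsm, hqc⟩ : AmbientDatum p K) (S.E.transform π D)),
      Rd _ _ R' ∧ ∀ ξ' : Z', S' ξ' = R'.mti

/-- Pure logic: a run in a regime shifts to a run in the same regime (drop the first stage) — runs have no preferred
origin, so «no infinite run» may be attacked from any stage. [folklore] -/
def Run.tail {N : Notions.{u} n} {Rd : Reading p K N} (r : Run N Rd) : Run N Rd where
  A k := r.A (k + 1)
  E k := r.E (k + 1)
  R k := r.R (k + 1)
  reads k := r.reads (k + 1)
  step k := r.step (k + 1)
  E_succ k := r.E_succ (k + 1)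

/-! ## ∇-centred runs — the manuscript's TERMINATING procedure («Domino-falls by ∇ blowups», §16.2 title p.84 l.2; Th. 16.6 (4)
## p.84 l.29 «D = ∇ and hence ∇′ = ∅»; Rem. 16.2 (2) p.81 l.23–25; §16.3 p.87 l.14–24) — APPENDED 2026-08-26 on the refuter's
## design finding D1 (res-L1-s47-dis-1, STATUS 20:50:08Z; L/res-L1-s47-dis-1/DISPROOF-LOG.md §D1)

READING NOTE (D1). The LITERAL centre rule `IsCentre` admits ANY smooth closed irreducible subscheme of `∇(E)` — in
particular a closed point of `∇(E)` with separable residue field — so `Run`/`Terminates`/`Diverges`/`RunFrom`/`DivergesFrom`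
above are the SUB-CENTRE notions: modulo the existence of résumés at every stage, a point tower over
`(𝔸³_K, ((z² − x³)𝒪, 2))` inhabits `Diverges N Rd Rg` for every `N`, `Rd` and each of `Regime.top / dimLE 3 / cartier /
charGT …` (the singular line is never touched), with no failure of Eq. (127) involved (at tower points in `∇′` Th. 16.6 (3)
asserts EQUALITY (128)). Hence «hence terminates» in the sense of Th. 16.13 must be read on the ∇-CENTRED runs below, whose
centre at every stage is a whole irreducible component of the terminal plat (Th. 16.6 (4) «`D = ∇`»; for reducible smooth
`∇` the components are disjoint and are blown up one at a time — DESIGN POINT (CMP): component-wise vs all of `∇` at once).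
`DecreaseAlongSteps` (one-step Eq. (127) off `D′` for EVERY admitted `D`) is unaffected and remains the rung shape; the
sub-centre `Terminates` stays on record as the weak notion it is. Nothing of the earlier declarations is changed. -/

section NablaRuns

variable {N : Notions.{u} n} {A : AmbientDatum p K} {E : IdealExponent A.Z}

/-- [OURS · L1 W4.6/W4.7] «`D` is an irreducible COMPONENT of the terminal plat `∇(E)`» — the centre of Th. 16.6 (4) p.84
l.29 («`D = ∇`», read component-wise for reducible smooth `∇`; DESIGN POINT (CMP)): `D ⊆ ∇(E)` is irreducible and maximal
among the irreducible subsets of `∇(E)`. NOT a statement of the manuscript. [folklore] -/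
structure IsNablaComponent (R : Resume N A E) (D : Closeds A.Z) : Prop where
  /-- `D ⊆ ∇(E)` -/
  subset_nabla : (D : Set A.Z) ⊆ (R.nabla : Set A.Z)
  /-- `D` irreducible -/
  irreducible : IsIrreducible (D : Set A.Z)
  /-- maximal: every irreducible `S` with `D ⊆ S ⊆ ∇(E)` equals `D` -/
  maximal : ∀ S : Set A.Z, IsIrreducible S → (D : Set A.Z) ⊆ S → S ⊆ (R.nabla : Set A.Z) → S = (D : Set A.Z)

/-- [OURS · L1 W4.6/W4.7] A ∇-STEP: a step of the typed procedure (`Step`: centre admitted by the literal rule, blow-up onto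
the next ambient datum over the same `K`) whose centre is an irreducible COMPONENT of `∇(E)` («∇ blowups», §16.2 p.84 l.2;
Th. 16.6 (4) p.84 l.29; Rem. 16.2 (2) p.81 l.23–25). NOT a statement of the manuscript. [folklore] -/
structure StepNabla (R : Resume N A E) (A' : AmbientDatum p K) extends Step R A' where
  /-- the centre is a whole irreducible component of the terminal plat -/
  component : IsNablaComponent R toStep.D

end NablaRuns

/-- [OURS · L1 W4.6/W4.7] AN INFINITE ∇-CENTRED RUN — the shape on which «hence terminates» (Th. 16.13 p.87 l.26–28, §16.3
p.87 l.14–24 «core-edge focusing is renewed … the repetition should sweep out the whole Sing») is to be read (D1): as `Run`,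
every step a `StepNabla`. NOT a statement of the manuscript. [folklore] -/
structure RunNabla (N : Notions.{u} n) (Rd : Reading p K N) where
  /-- the ambient datum at stage `k` -/
  A : ℕ → AmbientDatum p K
  /-- the ideal exponent at stage `k` -/
  E : ∀ k, IdealExponent (A k).Z
  /-- a résumé of `E k` (EXISTENCE posited at every stage) -/
  R : ∀ k, Resume N (A k) (E k)
  /-- every résumé is read by `Rd` -/
  reads : ∀ k, Rd (A k) (E k) (R k)
  /-- the ∇-step `Z_{k+1} → Z_k` (centre = a component of `∇(E_k)`) -/
  step : ∀ k, StepNabla (R k) (A (k + 1))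
  /-- `E_{k+1}` is the transform of `E_k` -/
  E_succ : ∀ k, E (k + 1) = (step k).toStep.E'

/-- [OURS · L1 W4.6/W4.7] a ∇-centred run is a run (forget the component condition); with the companion module's
`terminates_antitone`-style logic this gives `Terminates ⇒ TerminatesNabla`. [folklore] -/
def RunNabla.toRun {N : Notions.{u} n} {Rd : Reading p K N} (r : RunNabla N Rd) : Run N Rd where
  A := r.A
  E := r.E
  R := r.R
  reads := r.reads
  step k := (r.step k).toStep
  E_succ := r.E_succ

/-- [OURS · L1 W4.6/W4.7] «HENCE TERMINATES», ∇-CENTRED (the repaired reading per D1) — replaces the role of the termination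
half of Th. 16.13 p.87 l.26–28 for the typed procedure whose centres are the components of the terminal plats, restricted to
the regime `Rg`: there is NO infinite ∇-centred run all of whose stages lie in `Rg`. NOT a statement of the manuscript.
VACUITY: as (VAC) in the module docstring — contentful exactly for named notion instances with résumés; NOT refutable by
point towers (their centres are not components of `∇` once `∇` is positive-dimensional), which is the point of the repair;
still refutable by junk notion instances `N`, so rungs name `N`. SCOPE (Γ-FREE; OURS lane B 2026-08-26T21:23:31Z, v4
acknowledgement): Th. 16.13 p.87 l.27–29 reads «with all blowups of `Z` permissible for the given `E = (J,b)` AND FOR THE GIVEN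
`Γ`»; the NC-data `Γ` and `Γ`-permissibility are typed NOWHERE in this module, so `RunNabla`/`TerminatesNabla` are the Γ-FREE
∇-centred procedure (licensed as a separate reading by Rem. 16.2 (3)–(4) p.81 l.26–30 «separately and independently»); with
non-trivial `Γ` the manuscript's centres may be forced below whole components of `∇`, so NO rung may cite `TerminatesNabla` as
Th. 16.13 in full. [folklore] -/
def TerminatesNabla (N : Notions.{u} n) (Rd : Reading p K N) (Rg : Regime p K) : Prop :=
  ∀ r : RunNabla N Rd, (∀ k, Rg (r.A k) (r.E k)) → False

/-- [OURS · L1 W4.7] «the ∇-centred procedure DIVERGES somewhere in the regime» (negative side of `TerminatesNabla`; a W4.7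
(a′) «divergent family for the TYPED procedure» is an inhabitant — dis-1 D1: never a sub-centre run). NOT a statement of the
manuscript. [folklore] -/
def DivergesNabla (N : Notions.{u} n) (Rd : Reading p K N) (Rg : Regime p K) : Prop :=
  ∃ r : RunNabla N Rd, ∀ k, Rg (r.A k) (r.E k)

/-- [OURS · L1 W4.7] AN INFINITE ∇-CENTRED RUN FROM THE STATE `(A₀, E₀)` (as `RunFrom`, every step a `StepNabla`). NOT a
statement of the manuscript. [folklore] -/
structure RunFromNabla (N : Notions.{u} n) (Rd : Reading p K N) (A₀ : AmbientDatum p K) (E₀ : IdealExponent A₀.Z) where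
  /-- the ambient data of stages `1, 2, …` -/
  Asucc : ℕ → AmbientDatum p K
  /-- the ideal exponent at stage `k` -/
  E : ∀ k, IdealExponent (consA A₀ Asucc k).Z
  /-- the run starts at `E₀` -/
  E_zero : E 0 = E₀
  /-- a résumé of every stage (EXISTENCE posited) -/
  R : ∀ k, Resume N (consA A₀ Asucc k) (E k)
  /-- every résumé is read by `Rd` -/
  reads : ∀ k, Rd (consA A₀ Asucc k) (E k) (R k)
  /-- the ∇-step from stage `k` to stage `k + 1` -/
  step : ∀ k, StepNabla (R k) (consA A₀ Asucc (k + 1))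
  /-- `E_{k+1}` is the transform of `E_k` -/
  E_succ : ∀ k, E (k + 1) = (step k).toStep.E'

/-- [OURS · L1 W4.7] forgetting the initial state of a ∇-centred run. [folklore] -/
def RunFromNabla.toRunNabla {N : Notions.{u} n} {Rd : Reading p K N} {A₀ : AmbientDatum p K} {E₀ : IdealExponent A₀.Z}
    (r : RunFromNabla N Rd A₀ E₀) : RunNabla N Rd where
  A := consA A₀ r.Asucc
  E := r.E
  R := r.R
  reads := r.reads
  step := r.step
  E_succ := r.E_succ

/-- [OURS · L1 W4.7] «the ∇-centred procedure admits an infinite run from `(A₀, E₀)` inside `Rg`» — the repaired shape of a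
candidate divergent family (D1: `Campaign.TypedProcedureDiverges_<family>` := THIS at the family's initial datum, or a
one-step `¬ DecreaseAlongSteps` witness; never the sub-centre `DivergesFrom`). NOT a statement of the manuscript. [folklore] -/
def DivergesFromNabla (N : Notions.{u} n) (Rd : Reading p K N) (Rg : Regime p K) (A₀ : AmbientDatum p K)
    (E₀ : IdealExponent A₀.Z) : Prop :=
  ∃ r : RunFromNabla N Rd A₀ E₀, ∀ k, Rg (consA A₀ r.Asucc k) (r.E k)

/-! ## Reading sibling (M⁺): «the actual number `m` of stops» := `t + 1` — APPENDED 2026-08-27 (v4) on the kernel finding of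
## res-L1-s46-pv-7 (STATUS 2026-08-26T23:46:10Z; p471737 `Resume.m_eq_zero_iff_genDegOne_zero`, `not_eq127_of_m_eq_zero`,
## `Step.decrease_iff_of_m_eq_zero`) and after the S-side twin `Literature.AlgebraicGeometry.Hironaka2017.S16Proof.R019iRecomputeSucc`
## (reading `R⁺`, `ResumeWitness.toMTIDatumSucc`, res-type-019); OURS lane A of record on desk #32 (a2 2026-08-26T23:56:00Z: «a
## counter-instance ONLY under design point (M) m := t»)

READING NOTE (M / M⁺). The manuscript prints NO equation fixing the string length `m` of Eq. (127) («the actual number `m` of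
stops before reaching the terminal», p.84 l.17) in terms of the terminal index `t` of Def. 15.11 / (126) (p.80 l.29–33). Design
point (M) above reads `m := t` (strings over `𝒴(0), …, 𝒴(t−1)`). KERNEL EDGE OF (M) (pv-7, p471737, not restated here): with
`m = 0` — i.e. exactly when Def. 15.11's criterion already holds at stage `0` — the displayed (127) compares against the EMPTY
0-padded string and is unsatisfiable at every point, so `Step.Decrease` FAILS at any step having a closed point over `D` off
`D′`, for every notion instance; the rung (iv) «honest failure» forms `CampaignW46TameStall` / `…LargeCharTameStall`
(`MarkedTransferCampaignW46LargeCharStatement`) are instances of exactly this edge. The sibling (M⁺) reads `m := t + 1`: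
strings over `𝒴(0), …, 𝒴(t)`, the LAST entry `𝒴(m−1) = 𝒴(t)` being the stage whose singular locus is the terminal plat
`∇ = Sing(𝔜(t))` (Def. 15.12 p.80 l.36–37) — the reading under which §16.2's own uses of `𝒴(m−1)` refer to the `∇`-stage:
Cor. 16.9 p.85 l.31–35 («`Inv_{ξ′}(𝒴′(m−1)) <_lex Inv_ξ(𝒴(m−1))` … because `ξ′` is not in the strict transform `∇′` of `∇`
… while `π(ξ′) = ξ ∈ D ⊂ ∇`»), Lem. 16.10 / Eq. (131) p.85 l.36–38, the end of the proof p.86 l.22–35 («the ideal exponents of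
`𝒴(m−1)` are all resolved by … centers nowhere dense in the respective strict transforms of the original `∇` … `Sing(F̌(m−1))`
turns out to be empty»). (Th. 16.6 (4) p.84 l.29–30 «every `0 ≤ i ≤ m`» names `m + 1` stages — the genuine stages
`𝒴(0), …, 𝒴(t)` under (M), all stages displayed in (126) incl. `𝒴(t+1)` under (M⁺) — and does not separate the readings.)
Under (M⁺) `0 < m` by construction, so the (M)-edge never arises and Eq. (127) at a `t = 0` résumé compares
`(Inv_{ξ′}(𝒴′(0)), …)` with `(Inv_ξ(𝒴(0)))` — contentful.
NEITHER READING IS PREFERRED HERE; both are READINGS of p.84 l.17, not corrections, and nothing of (M) is changed: the decls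
below are the (M⁺) twins `Resume.mSucc` / `mtiSucc` / `invStrSucc`, `Step.DecreaseSucc` / `LengthLeSucc` / `DecreaseTSucc`,
`DecreaseAlongStepsSucc`, `primeRSucc` — same Lean shapes with `R.mtiSucc` for `R.mti`. A rung / negation file SAYS which
reading it instantiates; the companion anchors module relates the two (`Resume.invStrSucc_eq`: the (M⁺) string is the (M)
string followed by `Inv_ξ(𝒴(t))`; `decreaseAlongStepsSucc_of_thm16_6`: the (M⁺) rung shape is the typed candidate `Thm16_6`
with `prime := primeRSucc`, restricted to the regime). The ∇-centred run notions (`RunNabla`, `TerminatesNabla`, …) do not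
involve `m` and serve both readings unchanged; Eq. (128)-shapes built by rung files over `R.mti` (e.g. `Step.Equality` of
`MarkedTransferCampaignW46Threefolds`) have their own (M⁺) twins there, not here. -/

section ReadingSucc

namespace Resume

variable {N : Notions.{u} n} {A : AmbientDatum p K} {E : IdealExponent A.Z} (R : Resume N A E)

/-- [OURS · L1 W4.6/W4.7] DESIGN POINT (M⁺), reading sibling of `Resume.m`: «the actual number `m` of stops before reaching
the terminal» (p.84 l.17) := `t + 1`, `t` the terminal index of Def. 15.11 (strings run over `𝒴(0), …, 𝒴(t)`, terminal stage
INCLUDED; S-side twin `S16Proof.ResumeWitness.toMTIDatumSucc`). NOT a statement of the manuscript. [folklore] -/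
def mSucc : ℕ :=
  R.T.t + 1

/-- [OURS · L1 W4.6/W4.7] the row-019 résumé (`S16Proof.MTIDatum`) OF THIS résumé under reading (M⁺): as `Resume.mti`
(bridge `MTIDatum.ofARSchemes`, `∇ := R.nabla`, slot `R.invY`) with `m := R.mSucc`. NOT a statement of the manuscript.
[folklore] -/
def mtiSucc : MTIDatum A.Z n :=
  MTIDatum.ofARSchemes A E (fun i => (R.𝒴.step i).𝒴) R.nabla R.mSucc R.invY

/-- [OURS · L1 W4.6/W4.7] the `Inv`-string `(Inv_ξ(𝒴(0)), …, Inv_ξ(𝒴(t)))` of Eq. (127)/(128) p.84 l.11–16 at `ξ` under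
reading (M⁺) (row 019 `MTIDatum.invStr` at length `mSucc = t + 1`). NOT a statement of the manuscript. [folklore] -/
def invStrSucc (ξ : A.Z) : List (EdgeInv n) :=
  R.mtiSucc.invStr R.mSucc ξ

end Resume

namespace Step

variable {N : Notions.{u} n} {A A' : AmbientDatum p K} {E : IdealExponent A.Z} {R : Resume N A E} (s : Step R A')

/-- Eq. (127) FOR THE STEP `s`, reading R, under (M⁺) — twin of `Step.Decrease`: row 019's `Thm16_6_2` at `S := R.mtiSucc`,
`S′ := fun _ => R'.mtiSucc` (both strings of length `t + 1` resp. `t′ + 1`, compared with 0-padding). OURS instantiation;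
NOT a statement of the manuscript and not asserted; claim tag because its content is the consequence-shape of a claim
under review. [claim: Hironaka2017, status: under-review] -/
def DecreaseSucc (R' : Resume N A' s.E') : Prop :=
  Thm16_6_2 R.mtiSucc s.π s.D (fun _ => R'.mtiSucc)

/-- «that is to say `m′ ≤ m`» (p.84 l.17–18) FOR THE STEP `s` under (M⁺) — twin of `Step.LengthLe` (`t′ + 1 ≤ t + 1`, the
same condition as under (M); kept as a separate decl so that (M⁺) rungs are literally `Thm16_6_2 ∧ Thm16_6_2_mle` at
`R.mtiSucc`). OURS instantiation; not asserted. [claim: Hironaka2017, status: under-review] -/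
def LengthLeSucc (R' : Resume N A' s.E') : Prop :=
  Thm16_6_2_mle R.mtiSucc s.π s.D (fun _ => R'.mtiSucc)

/-- Eq. (127) FOR THE STEP `s`, reading T, under (M⁺) — twin of `Step.DecreaseT`: the primed résumé is the member-wise
transform `R.mtiSucc.transformT s.π s.D m' invY'` (row 019c) for a number of stops `m′` and a primed `Inv`-slot `invY′`.
One step only. OURS instantiation; not asserted. [claim: Hironaka2017, status: under-review] -/
def DecreaseTSucc (m' : ℕ) (invY' : ℕ → A'.Z → EdgeInv n) : Prop :=
  Thm16_6_2 R.mtiSucc s.π s.D (fun _ => R.mtiSucc.transformT s.π s.D m' invY')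

end Step

/-- [OURS · L1 W4.6/W4.7] THE ONE-STEP SHAPE under reading (M⁺) — twin of `DecreaseAlongSteps` with `Step.DecreaseSucc` /
`Step.LengthLeSucc`: for every state `(A, E, R)` in the regime `Rg` read by `Rd`, every step `s` permitted by the typed centre
rule and every résumé `R′` of the transform read by `Rd`, Eq. (127) (strings of length `t + 1`, `t′ + 1`) holds at the closed
points over the centre off `D′`, and `m′ ≤ m`. Replaces the role of Th. 16.6 (2) / Eq. (127) p.84 l.10–20 restricted to a
regime, READ WITH `m := t + 1`; NOT a statement of the manuscript. VACUITY: module docstring (VAC), unchanged — and, unlike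
the (M) shape, NOT refuted by `t = 0` résumés (pv-7's edge), which is the reason for this twin. [folklore] -/
def DecreaseAlongStepsSucc (N : Notions.{u} n) (Rd : Reading p K N) (Rg : Regime p K) : Prop :=
  ∀ (A : AmbientDatum p K) (E : IdealExponent A.Z) (R : Resume N A E), Rg A E → Rd A E R →
    ∀ (A' : AmbientDatum p K) (s : Step R A') (R' : Resume N A' s.E'), Rd A' s.E' R' →
      s.DecreaseSucc R' ∧ s.LengthLeSucc R'

/-- [OURS · L1 W4.6/W4.7] the instance of row 019's relation parameter `prime` of `S16Proof.Thm16_6` that reading R denotes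
UNDER (M⁺) — twin of `primeR`: the local primed résumés `S′ ξ′` all equal the (M⁺) row-019 résumé `R′.mtiSucc` of SOME
résumé `R′` (read by `Rd`) of the transform of `S.E` on SOME ambient-datum structure of `Z′` over `K`. With it the companion
module proves `decreaseAlongStepsSucc_of_thm16_6`. NOT a statement of the manuscript. [folklore] -/
def primeRSucc (N : Notions.{u} n) (Rd : Reading p K N) :
    ∀ {Z Z' : Scheme.{u}}, MTIDatum Z n → (Z' ⟶ Z) → Closeds Z → (Z' → MTIDatum Z' n) → Prop :=
  fun {_ Z'} S π D S' =>
    ∃ (f' : Z' ⟶ Spec (.of K)) (hirr : IrreducibleSpace Z') (hsm : Smooth f') (hqc : QuasiCompact f')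
      (R' : Resume N (⟨Z', f', hirr, hsm, hqc⟩ : AmbientDatum p K) (S.E.transform π D)),
      Rd _ _ R' ∧ ∀ ξ' : Z', S' ξ' = R'.mtiSucc

end ReadingSucc

/-! ## Regime vocabulary addendum (v4): finite singular locus (res-L1-s46-pv-1, STATUS 2026-08-26T22:43:24Z request (a)) -/

namespace Regime

/-- [OURS · L1 W4.6] the regime «`Sing(E)` is a finite set of points of `Z`» (row 001 `IdealExponent.sing`) — the first
conjunct of the rung (i-a)/(iii) regimes (cf. `Regime.mohWindowCurve` of `MarkedTransferCampaignW46MohWindow`, which carries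
`E.sing.Finite ∧ E.sing ⊆ closedPoints A.Z` inline); combine with `Regime.inter`. Under the LITERAL sub-centre rule the
procrastination refutation of `Terminates` (`MarkedTransferCampaignW46LiteralCentreProcrastination`, pv-1) needs `Sing(E)`
INFINITE at every stage, which this regime excludes. NOT a statement of the manuscript. [folklore] -/
def singFinite : Regime p K :=
  fun _ E => E.sing.Finite

end Regime

end CampaignW46

end Summit.ResolutionOfSingularities.ResolutionOfSingularities.Theorems

end
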